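import Summits.Ventures.HodgeKum4.Theorems.KummerFixedLocusL1HilbDefs
import Literature.AlgebraicGeometry.HilbertScheme.LefschetzDualTransfer
import Literature.AlgebraicGeometry.HilbertScheme.LefschetzDualHilbertScheme
import Mathlib.LinearAlgebra.Matrix.ToLin
import Mathlib.Algebra.Polynomial.BigOperators
import Mathlib.Algebra.Polynomial.Roots
import HarnessLib

/-!
# Lane (V), line v2p5 — stub S-E (auxiliaries): transport `Φ_b`, homogeneity, Vandermonde, `StableUnder` calculus

Cell `hodge-kum4`, crux stmt-Ventures-20141, registered stub `stub_eval` of the v2p5 skeleton.  Pure algebra over the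
interface: given the certificate `LieCert` (stub S-D), the super Lie-homomorphism property of transfer operators (stub
S-A, taken as the hypothesis `hLie`), a homogeneous basis `b` of `H*(S)` in which left cup products by `b I` and the
operator `Λ` are the model matrices `mulMat I`, `lamMat`, and a subspace `W ⊆ H*(S^[n])` stable under the blocks of
`T₁(m_{bI})` (`1 ≤ |I| ≤ 3`) and `T₋₁(Λ)`: every node of the certificate's program gives a transfer operator
`T_{tdeg}(Φ node)` stabilising `W` (induction along the program, `[T_t φ, T_{t'} ψ} = T_{t+t'}[φ,ψ}`); `[E,E] ⊇ E`,
`[E,O] ⊇ O` push `E` (`O`) to all `t`-degrees `−2i` (`−2i−1`); since `T_t(φ)|ₙ = −Σ_{k≤n} k^{t−1} τ_k(φ)|ₙ`, a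
Vandermonde/Lagrange inversion in the nodes `k⁻²` extracts every single-weight `τ_k(φ)|ₙ`, and `1`, `E_{I,0} ∈ span(E∪O)`
give the number operators `τ_k(id)|ₙ` and the polarisations `τ_k(b I ⊗ b₀^∨)|ₙ`.  V2-MECHANISM §1–§4.
Nothing here asserts L1-Hilb(n) / L1 / HC_Kum4Type / HC.
-/

noncomputable section

open DirectSum Polynomial
open scoped TensorProduct
open Literature.AlgebraicTopology.SingularHomology
open Literature.AlgebraicGeometry Literature.AlgebraicGeometry.Hyperkaehler Literature.AlgebraicGeometry.HilbertScheme
open Literature.AlgebraicGeometry.Motives (ComplexPoints SchemeOver IsSmoothProjective)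

namespace Summit.Ventures.HodgeKum4.L1Hilb

namespace Eval

variable {S : SchemeOver ℂ}

/-! ### The transport `Φ_b : Mat₁₆(ℤ) → End(H*(S))` along a basis `b` -/

/-- `Φ_b(M) = toLin b b (M ⊗ ℂ)`, as a ring homomorphism. -/
def Φ (b : Module.Basis (Fin 16) ℂ (totalCohomology ℂ (ComplexPoints S))) :
    Matrix (Fin 16) (Fin 16) ℤ →+* Module.End ℂ (totalCohomology ℂ (ComplexPoints S)) :=
  (Matrix.toLinAlgEquiv b).toRingEquiv.toRingHom.comp (Int.castRingHom ℂ).mapMatrix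

variable (b : Module.Basis (Fin 16) ℂ (totalCohomology ℂ (ComplexPoints S)))

/-- Unfolding `Φ`. -/
theorem Φ_apply (M : Matrix (Fin 16) (Fin 16) ℤ) : Φ b M = Matrix.toLin b b (M.map (Int.castRingHom ℂ)) := rfl

/-- `Φ` on a basis vector: `Φ(M)(b P) = Σ_Q M_{QP} b Q`. -/
theorem Φ_basis (M : Matrix (Fin 16) (Fin 16) ℤ) (P : Fin 16) : Φ b M (b P) = ∑ Q, (M Q P : ℂ) • b Q := by
  rw [Φ_apply, Matrix.toLin_self]
  rfl

/-- `Φ` is compatible with integer scalars. -/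
theorem Φ_zsmul (c : ℤ) (M : Matrix (Fin 16) (Fin 16) ℤ) : Φ b (c • M) = (c : ℂ) • Φ b M := by
  rw [Φ_apply, Φ_apply]
  have : (c • M).map (Int.castRingHom ℂ) = (c : ℂ) • M.map (Int.castRingHom ℂ) := by
    ext i j; simp only [Matrix.map_apply, Matrix.smul_apply, smul_eq_mul, eq_intCast, Int.cast_mul]
  rw [this, map_smul]

/-- `Φ` takes the model super-bracket to the super-commutator. -/
theorem Φ_sbrMat (A : Matrix (Fin 16) (Fin 16) ℤ) (da : ℤ) (B : Matrix (Fin 16) (Fin 16) ℤ) (db : ℤ) :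
    Φ b (sbrMat A da B db) = superBracket ℂ (Φ b A) (Φ b B) da.natAbs db.natAbs := by
  rw [sbrMat, superBracket, map_sub, map_mul, Φ_zsmul, map_mul]
  norm_cast

/-- `Φ(E_{I,0})` is the polarisation `x ↦ b₀^∨(x) · b I`. -/
theorem Φ_single (I : Fin 16) : Φ b (Matrix.single I 0 1) = polar b 0 I := by
  refine b.ext fun P ↦ ?_
  rw [Φ_basis, polar, LinearMap.smulRight_apply, Module.Basis.coord_apply, Module.Basis.repr_self]
  simp only [Matrix.single_apply, Finsupp.single_apply]
  by_cases hP : P = 0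
  · subst hP
    rw [Finset.sum_eq_single I]
    · simp
    · intro Q _ hQ
      rw [if_neg (fun h ↦ hQ h.1.symm), Int.cast_zero, zero_smul]
    · simp
  · rw [if_neg hP, zero_smul]
    refine Finset.sum_eq_zero fun Q _ ↦ ?_
    rw [if_neg (fun h ↦ hP h.2.symm), Int.cast_zero, zero_smul]

/-! ### Homogeneity: `IsHomogMat M d ⇒ Φ(M)` has degree `d` (for a homogeneous basis) -/

variable {b}

/-- In a basis of homogeneous vectors, a homogeneous class is a combination of basis vectors of its own degree. -/
theorem repr_eq_zero_of_deg_ne (hb : ∀ I, b I ∈ LinearMap.range (ofDegree ℂ (ComplexPoints S) (deg4 I)))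
    (k : ℕ) (x : singularCohomology ℂ ℂ (ComplexPoints S) k) (J : Fin 16) (hJ : deg4 J ≠ k) :
    b.repr (ofDegree ℂ (ComplexPoints S) k x) J = 0 := by
  -- the projection `π_k` onto `H^k` fixes `ofDegree k x` and kills `b J` for `deg4 J ≠ k`
  set πk : Module.End ℂ (totalCohomology ℂ (ComplexPoints S)) :=
    ofDegree ℂ (ComplexPoints S) k ∘ₗ DirectSum.component ℂ ℕ (fun i ↦ singularCohomology ℂ ℂ (ComplexPoints S) i) k
  have hfix : πk (ofDegree ℂ (ComplexPoints S) k x) = ofDegree ℂ (ComplexPoints S) k x := by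
    simp only [πk, LinearMap.coe_comp, Function.comp_apply]
    erw [DirectSum.component.lof_self]
  have hkill : ∀ Q, deg4 Q ≠ k → πk (b Q) = 0 := by
    intro Q hQ
    obtain ⟨y, hy⟩ := hb Q
    rw [← hy]
    simp only [πk, LinearMap.coe_comp, Function.comp_apply]
    erw [DirectSum.component.of, dif_neg hQ]
    rw [map_zero]
  have hfix' : ∀ Q, deg4 Q = k → πk (b Q) = b Q := by
    intro Q hQ
    obtain ⟨y, hy⟩ := hb Q
    rw [← hy]
    subst hQ
    simp only [πk, LinearMap.coe_comp, Function.comp_apply]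
    erw [DirectSum.component.lof_self]
  -- expand in the basis and compare coefficients of `b J`
  have hexp := b.linearCombination_repr (ofDegree ℂ (ComplexPoints S) k x)
  rw [Finsupp.linearCombination_apply, Finsupp.sum_fintype _ _ (by simp)] at hexp
  have h2 := congrArg πk hexp
  rw [hfix, map_sum] at h2
  -- `h2 : Σ_Q πk (c_Q • b Q) = ofDegree k x`; apply `b.repr · J`
  have h3 := congrArg (fun v ↦ b.repr v J) h2
  simp only [map_smul, map_sum] at h3
  rw [Finset.sum_apply'] at h3
  rw [← h3]
  refine Finset.sum_eq_zero fun Q _ ↦ ?_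
  by_cases hQ : deg4 Q = k
  · rw [hfix' Q hQ, b.repr_self, Finsupp.smul_apply, Finsupp.single_apply, if_neg (by rintro rfl; exact hJ hQ),
      smul_zero]
  · rw [hkill Q hQ, map_zero, smul_zero, Finsupp.zero_apply]

/-- `Φ(M)` has degree `d` whenever `M` is `deg4`-homogeneous of degree `d` and the basis is homogeneous. -/
theorem isOfDegree_Φ (hb : ∀ I, b I ∈ LinearMap.range (ofDegree ℂ (ComplexPoints S) (deg4 I)))
    {M : Matrix (Fin 16) (Fin 16) ℤ} {d : ℤ} (hM : IsHomogMat M d) : IsOfDegree ℂ (ComplexPoints S) (Φ b M) d := by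
  intro k x
  -- `ofDegree k x = Σ_{deg J = k} c_J b J`
  have hexp := b.linearCombination_repr (ofDegree ℂ (ComplexPoints S) k x)
  rw [Finsupp.linearCombination_apply, Finsupp.sum_fintype _ _ (by simp)] at hexp
  rw [← hexp, map_sum]
  refine Submodule.sum_mem _ fun J _ ↦ ?_
  by_cases hJ : deg4 J = k
  · rw [map_smul]
    refine Submodule.smul_mem _ _ ?_
    rw [Φ_basis]
    refine Submodule.sum_mem _ fun Q _ ↦ ?_
    by_cases hQ : M Q J = 0
    · rw [hQ, Int.cast_zero, zero_smul]; exact Submodule.zero_mem _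
    · have hdeg := hM Q J hQ
      rw [hJ] at hdeg
      refine Submodule.smul_mem _ _ ?_
      unfold shiftedPart
      rw [if_pos (by omega)]
      obtain ⟨y, hy⟩ := hb Q
      rw [show ((k : ℤ) + d).toNat = deg4 Q by omega, ← hy]
      exact LinearMap.mem_range_self _ y
  · rw [repr_eq_zero_of_deg_ne hb k x J hJ, zero_smul, map_zero]
    exact Submodule.zero_mem _

/-! ### Vandermonde / Lagrange inversion in a submodule -/

/-- If `Σ_{i ∈ s} x_i^m • v_i ∈ 𝒲` for all `m < |s|` with the `x_i` pairwise distinct, then every `v_i ∈ 𝒲`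
(evaluate the Lagrange polynomial `∏_{l ≠ i} (X − x_l)`). -/
theorem mem_of_vandermonde {K M ι : Type*} [Field K] [AddCommGroup M] [Module K M] [DecidableEq ι]
    (𝒲 : Submodule K M) (s : Finset ι) (x : ι → K) (hx : Set.InjOn x s) (v : ι → M)
    (h : ∀ m : ℕ, m < s.card → ∑ i ∈ s, x i ^ m • v i ∈ 𝒲) {i : ι} (hi : i ∈ s) : v i ∈ 𝒲 := by
  classical
  set p : K[X] := ∏ l ∈ s.erase i, (X - C (x l)) with hp
  have hdeg : p.natDegree < s.card := by
    rw [hp, natDegree_finsetProd_X_sub_C_eq_card, Finset.card_erase_of_mem hi]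
    exact Nat.sub_lt (Finset.card_pos.mpr ⟨i, hi⟩) one_pos
  -- `Σ_m p_m • (Σ_i x_i^m • v_i) = Σ_i p(x_i) • v_i = p(x_i) • v_i`
  have hmem : ∑ m ∈ Finset.range s.card, p.coeff m • ∑ l ∈ s, x l ^ m • v l ∈ 𝒲 :=
    Submodule.sum_mem _ fun m hm ↦ Submodule.smul_mem _ _ (h m (Finset.mem_range.mp hm))
  have hswap : ∑ m ∈ Finset.range s.card, p.coeff m • ∑ l ∈ s, x l ^ m • v l = ∑ l ∈ s, p.eval (x l) • v l := by
    simp_rw [Finset.smul_sum, smul_smul]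
    rw [Finset.sum_comm]
    refine Finset.sum_congr rfl fun l _ ↦ ?_
    rw [← Finset.sum_smul, eval_eq_sum_range' hdeg]
  have hvan : ∀ l ∈ s, l ≠ i → p.eval (x l) = 0 := by
    intro l hl hli
    rw [hp, eval_prod]
    exact Finset.prod_eq_zero (Finset.mem_erase.mpr ⟨hli, hl⟩) (by simp)
  have hval : ∑ l ∈ s, p.eval (x l) • v l = p.eval (x i) • v i := by
    rw [Finset.sum_eq_single_of_mem i hi fun l hl hli ↦ by rw [hvan l hl hli, zero_smul]]
  have hne : p.eval (x i) ≠ 0 := by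
    rw [hp, eval_prod]
    refine Finset.prod_ne_zero_iff.mpr fun l hl ↦ ?_
    rw [eval_sub, eval_X, eval_C, sub_ne_zero]
    exact fun h ↦ (Finset.mem_erase.mp hl).1 (hx (Finset.mem_of_mem_erase hl) hi h.symm)
  rw [hswap, hval] at hmem
  rw [← inv_smul_smul₀ hne (v i)]
  exact Submodule.smul_mem _ _ hmem

/-! ### Blocks on `ℍₙ` and `StableUnder` -/

variable {hS : IsSmoothProjective 2 S} {H : HilbertSchemesOfPoints S}

section Stable

variable (n : ℕ) (W : Submodule ℂ (totalCohomology ℂ (ComplexPoints (H.obj n))))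

/-- `(X + Y)|ₙ = X|ₙ + Y|ₙ`. -/
theorem restrictFock_add' (X Y : Module.End ℂ (fockSpace H)) :
    restrictFock ℂ (fockFamily H) (X + Y) n = restrictFock ℂ (fockFamily H) X n + restrictFock ℂ (fockFamily H) Y n := by
  ext y; simp [restrictFock]

/-- `(c • X)|ₙ = c • X|ₙ`. -/
theorem restrictFock_smul' (c : ℂ) (X : Module.End ℂ (fockSpace H)) :
    restrictFock ℂ (fockFamily H) (c • X) n = c • restrictFock ℂ (fockFamily H) X n := by
  ext y; simp [restrictFock]

variable {n W}

/-- `StableUnder` is closed under sums. -/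
theorem StableUnder.add {X Y : Module.End ℂ (fockSpace H)} (hX : StableUnder n W X) (hY : StableUnder n W Y) :
    StableUnder n W (X + Y) := by
  refine ⟨fun y ↦ ?_, fun w hw ↦ ?_⟩
  · rw [LinearMap.add_apply]; exact Submodule.add_mem _ (hX.1 y) (hY.1 y)
  · rw [restrictFock_add', LinearMap.add_apply]; exact Submodule.add_mem _ (hX.2 w hw) (hY.2 w hw)

/-- `StableUnder` is closed under scalars. -/
theorem StableUnder.smul (c : ℂ) {X : Module.End ℂ (fockSpace H)} (hX : StableUnder n W X) :
    StableUnder n W (c • X) := by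
  refine ⟨fun y ↦ ?_, fun w hw ↦ ?_⟩
  · rw [LinearMap.smul_apply]; exact Submodule.smul_mem _ _ (hX.1 y)
  · rw [restrictFock_smul', LinearMap.smul_apply]; exact Submodule.smul_mem _ _ (hX.2 w hw)

/-- `StableUnder` is closed under composition. -/
theorem StableUnder.mul {X Y : Module.End ℂ (fockSpace H)} (hX : StableUnder n W X) (hY : StableUnder n W Y) :
    StableUnder n W (X * Y) := by
  refine ⟨fun y ↦ ?_, fun w hw ↦ ?_⟩
  · obtain ⟨z, hz⟩ := hY.1 y
    rw [Module.End.mul_apply, ← hz]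
    exact hX.1 z
  · rw [restrictFock_mul hY.1, Module.End.mul_apply]
    exact hX.2 _ (hY.2 w hw)

/-- `(X − Y)|ₙ = X|ₙ − Y|ₙ`. -/
theorem restrictFock_sub' (X Y : Module.End ℂ (fockSpace H)) :
    restrictFock ℂ (fockFamily H) (X - Y) n = restrictFock ℂ (fockFamily H) X n - restrictFock ℂ (fockFamily H) Y n := by
  ext y; simp [restrictFock]

/-- `StableUnder` is closed under differences. -/
theorem StableUnder.sub {X Y : Module.End ℂ (fockSpace H)} (hX : StableUnder n W X) (hY : StableUnder n W Y) :
    StableUnder n W (X - Y) := by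
  refine ⟨fun y ↦ ?_, fun w hw ↦ ?_⟩
  · rw [LinearMap.sub_apply]; exact Submodule.sub_mem _ (hX.1 y) (hY.1 y)
  · rw [restrictFock_sub', LinearMap.sub_apply]; exact Submodule.sub_mem _ (hX.2 w hw) (hY.2 w hw)

/-- `StableUnder` is closed under super-brackets. -/
theorem StableUnder.superBracket {X Y : Module.End ℂ (fockSpace H)} (hX : StableUnder n W X)
    (hY : StableUnder n W Y) (p q : ℕ) : StableUnder n W (superBracket ℂ X Y p q) := by
  show StableUnder n W (X * Y - _ • (Y * X))
  exact StableUnder.sub (StableUnder.mul hX hY) (StableUnder.smul _ (StableUnder.mul hY hX))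

/-- The zero operator is (trivially) `StableUnder`. -/
theorem stableUnder_zero : StableUnder n W (0 : Module.End ℂ (fockSpace H)) :=
  ⟨fun y ↦ by simp, fun w hw ↦ by simp [restrictFock]⟩

/-- `StableUnder` is closed under list sums. -/
theorem StableUnder.list_sum {α : Type} (l : List α) (f : α → Module.End ℂ (fockSpace H))
    (h : ∀ a ∈ l, StableUnder n W (f a)) : StableUnder n W (l.map f).sum := by
  induction l with
  | nil => simpa using stableUnder_zero
  | cons a l ih =>
    rw [List.map_cons, List.sum_cons]
    exact StableUnder.add (h a List.mem_cons_self) (ih fun a' ha' ↦ h a' (List.mem_cons_of_mem _ ha'))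

end Stable

/-! ### Transfer operators: linearity in `φ`, list sums, blocks as sums of single weights -/

section Transfer

variable (𝔑 : NakajimaOperators hS H)
  (C : totalCohomology ℂ (ComplexPoints S) ⊗[ℂ] totalCohomology ℂ (ComplexPoints S)) (t : ℤ)

/-- `T_t` of a list sum `Σ c • φ`. -/
theorem transferOp_list_sum {α : Type} (l : List α) (c : α → ℂ)
    (φ : α → Module.End ℂ (totalCohomology ℂ (ComplexPoints S))) :
    transferOp ℂ 𝔑.q C t (l.map fun a ↦ c a • φ a).sum = (l.map fun a ↦ c a • transferOp ℂ 𝔑.q C t (φ a)).sum := by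
  induction l with
  | nil => simpa using transferOp_smul 𝔑.q C t (0 : ℂ) (0 : Module.End ℂ (totalCohomology ℂ (ComplexPoints S)))
  | cons a l ih => rw [List.map_cons, List.sum_cons, transferOp_add, transferOp_smul, ih, List.map_cons, List.sum_cons]

/-- `τ_k|ₙ` of a list sum `Σ c • φ`. -/
theorem twoPt_list_sum {α : Type} (l : List α) (c : α → ℂ)
    (φ : α → Module.End ℂ (totalCohomology ℂ (ComplexPoints S))) (k n : ℕ) :
    twoPt 𝔑 C (l.map fun a ↦ c a • φ a).sum k n = (l.map fun a ↦ c a • twoPt 𝔑 C (φ a) k n).sum := by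
  induction l with
  | nil =>
    simp only [List.map_nil, List.sum_nil, twoPt]
    rw [show transferTerm ℂ 𝔑.q C (0 : Module.End ℂ (totalCohomology ℂ (ComplexPoints S))) (k : ℤ) = 0 by
      simpa using transferTerm_smul 𝔑.q C (0 : ℂ) (0 : Module.End ℂ (totalCohomology ℂ (ComplexPoints S))) (k : ℤ)]
    ext y; simp [restrictFock]
  | cons a l ih =>
    rw [List.map_cons, List.sum_cons, twoPt, transferTerm_add, transferTerm_smul, restrictFock_add',
      restrictFock_smul', ← twoPt, ← twoPt, ih, List.map_cons, List.sum_cons]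

/-- `τ_k|ₙ` is homogeneous in `φ`. -/
theorem twoPt_smul (c : ℂ) (φ : Module.End ℂ (totalCohomology ℂ (ComplexPoints S))) (k n : ℕ) :
    twoPt 𝔑 C (c • φ) k n = c • twoPt 𝔑 C φ k n := by
  rw [twoPt, transferTerm_smul, restrictFock_smul', twoPt]

/-- **The block of a transfer operator is a sum of single weights**: `T_t(φ)|ₙ = −Σ_{k=1}^{n} k^{t−1} τ_k(φ)|ₙ`. -/
theorem restrictFock_transferOp (φ : Module.End ℂ (totalCohomology ℂ (ComplexPoints S))) (n : ℕ) :
    restrictFock ℂ (fockFamily H) (transferOp ℂ 𝔑.q C t φ) n =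
      -∑ k ∈ Finset.Icc 1 n, ((k : ℂ) ^ (t - 1)) • twoPt 𝔑 C φ k n := by
  refine LinearMap.ext fun y ↦ ?_
  rw [restrictFock_apply, transferOp_apply_ofSummand, map_neg, map_sum, LinearMap.neg_apply, LinearMap.sum_apply]
  simp only [map_smul, LinearMap.smul_apply]
  rfl

end Transfer

end Eval

end Summit.Ventures.HodgeKum4.L1Hilb

end
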